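import Summits.BirchSwinnertonDyer.Rank1Residual.X11b.Three.ClassRecordAtThree
import Summits.BirchSwinnertonDyer.Rank1Residual.X11b.Three.JetchevShapeOverK
import HarnessLib

/-!
# Class X11b at `p = 3` (team N8/O2 = cell `b2b-bsdres`, seat x11b3-p8, lead deal #5 (R5-3), S12):
# the (T4″)@3 CORNER — its three typed inputs WITHOUT `Surj`/`Ram` (ONE definitions home)

HONEST FRAMING (verbatim, cell `b2b-bsdres`, run/shared/lean/b2b/bsd-rank1-residual/): the goal of
the cell is to DELETE the COMBINATION-SHAPED residual classes for ALL analytic-rank `≤ 1` curves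
over `ℚ` — "full BSD formula for every rank `≤ 1` curve in class `C`" assembled STRICTLY from
published theorems — so that the rank-`≤ 1` remainder becomes exactly the CONSTRUCTION-SHAPED
classes, which are TYPED (missing-input Props), NOT attempted; this is not "finishing BSD".
Research route; nothing booked; NO label changes; census numbers are EVIDENCE (x11b3-p6's CORNER
CENSUS, `cells/x11b3/CORNER-CENSUS.md`, two engines 296/296), never facts. THREE shape-only
`Prop`-valued predicates ("typed open input, no source, CONSTRUCTION-SHAPED"; tagged `@[conjecture]`:
each is implied by BSD, nothing asserted) and bridge theorems; NO named fact; no `sorry`.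

## The corner and why its inputs carry neither `Surj W 3` nor `Ram W 3`

The (T4″)@3 corner of X11b@3 is `¬ Surj W 3` (image of `ρ̄_{E,3}` a `2`-group in the normaliser of a
Cartan, labels 3Ns / 3Nn; 296 class-pairs, 0 TRUE-OPEN — it matters ONLY for the `∀ E` class
theorem `Three.forall_bsdp_of_classRecord`, x11b3-p3 p252266, binders `hCs`/`hCn`). In the kernel
`¬ Surj ∧ (irr) ⇒ 3 ∣ ord₃ Δ_min ∧ ¬ Ram` (`ClassX11b.dvd_and_not_ram_of_not_surj`), so EVERY consumer
carrying `Surj W 3` or `Ram W 3` is void there (x11b3-p3 / x11b3-p6 / lead R5-1 correction of record).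
Road (b)'s chain at an odd-`d_K` Manin-good Heegner datum (`exists_oddHeegnerData`;
`BDPRouteHalves.missingLowerBoundAt_of_indexLowerBoundAt` / `missingUpperBoundAt_of_shaIndexBound`;
`BDPRouteOddOnTree.indexLowerBoundAt_of_heegner_of_openInput_prime`) is IMAGE-FREE: it takes
`hr hp2 hmult hirr`, never `Surj`. What it consumes, and what survives on the corner:
* (I1) STEP L at the datum ⇐ the open input "(IMC≥)∘(BDP)" in S0 currency. `Three.StepLAt W` reads
  `ClassX11b W 3 → Surj W 3 → …` and is VACUOUSLY TRUE on the corner, so it cannot be aliased: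
  **`CornerStepLAt W`** is its body VERBATIM with `¬ Surj W 3 →` [NO source at `3`; every printed
  anticyclotomic divisibility has big image].
* (I2)/(I3) the rank-`0` `3`-part of the twist `E^{d_K}` — its `≤`-half feeds E's LOWER half
  (print: Wuthrich 2014 Prop. 21, surjective-or-Borel image — VOID: `ρ̄_{E^d,3} = ρ̄_{E,3} ⊗ χ_d` is
  irreducible non-surjective), its `≥`-half feeds E's UPPER half (print: Skinner 2016 Thm. C,
  (irr)+(ram) — VOID: `Ram(E^d) ⟺ Ram(E)`): **`CornerTwistAt W`** := `BSD(E^{d_K},3)` for the Heegner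
  twists [NO source; the twist pair is rank `0`, `3 ∥ N`, (irr), `¬Surj`, `¬Ram` — the rank-`0`
  corner: a cross-class link, not a new independent residual].
* (I4) the `K`-bound `ord₃ #Ш(E/K) ≤ 2·ord₃ [E(K):ℤP]`: PUBLISHED AND REGISTERED, image-free —
  Matar–Nekovář 2019 Thm. 0.3 + §0.11 = `MatarNekovar2019.thm03_padicValNat_card_sha_le_of_irreducible`
  (Cha 2005 Thm. 21 is the same at `3 ∥ N`, `3 ∤ D_K`; the registered Cha typing is over `ℚ` and does
  not feed the chain). It is blind to the Tamagawa term `2·ord₃ ∏_ℓ c_ℓ(E)`: it closes the upper half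
  exactly on `3 ∤ ∏c` (corner (C1): 88 class-pairs, all non-split; x11b3-p8 p253189
  `missingUpperBoundAt_of_matarNekovar_of_not_dvd`).
* (I5) on `3 ∣ ∏c` — ALL 129 split-corner pairs (`c₃ = ord₃ Δ_min ≡ 0 mod 3`) and 79 non-split ones
  (a split multiplicative `ℓ ≠ 3` with `3 ∣ v_ℓ(Δ)`) — the Tamagawa-SHARP `K`-bound
  **`CornerUpperAt W`**: `ord₃ #Ш(E/K) + 2·ord₃ ∏_ℓ c_ℓ(E) ≤ 2·ord₃ [E(K):ℤP]` at the datum [NO source: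
  Jetchev 2008's sharpening is printed for `p ∤ N` and `ρ̄` onto — fails twice; = the (T2α)/(T2β)
  upper binders of the class record restated WITHOUT `Ram`/`Surj`].
Bridges (theorems, image-free): `indexLowerBoundAt_of_cornerStepLAt` (S0 ⇒ Gross–Zagier currency),
`pPartRankZero_of_cornerTwistAt` (⇒ both twist halves in Jetchev–Skinner–Wan Thm. 7.2.1 shape),
`missingUpperBoundAt_of_cornerUpperAt` (+ `CornerTwistAt` ⇒ the `ℚ`-level Euler-system half on
`3 ∣ ∏c`). Consumers: x11b3-p3's whole-corner discharge `Three.missingPPartAt_of_corner_of_inputs`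
(S13) and x11b3-p8's `Three.missingPPartAt_of_corner_split` (`CornerSplitResidual.lean`).

References: [MatarNekovar2019] Thm. 0.3, §0.11, Prop. 5.26 (2), Cor. 5.21 (e′); [Cha2005] Thm. 21;
[JetchevSkinnerWan2017] Thm. 7.2.1, §7.4.1–7.4.2; [Castella2018] Thm. 3.2 (shape); [Wuthrich2014]
Prop. 21; [Skinner2016PacificMC] Thm. C; [Jetchev2008] Thm. 1.1; [GrossLMS1991] (2.2);
[Miller2011LMS] Def. 1.1; cells/x11b3/CORNER-CENSUS.md §2–§4; OWNERS.md deal #5 (R5-1/R5-3/R5-4).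
-/

noncomputable section

open scoped Classical

open WeierstrassCurve NumberField IsDedekindDomain Field Literature.NumberTheory.EllipticCurves
  Rat.HeightOneSpectrum
  Literature.NumberTheory.DiophantineGeometry
  Literature.NumberTheory.EllipticCurves.GreenbergSelmer
  Literature.NumberTheory.EllipticCurves.ModularForms
  Literature.NumberTheory.EllipticCurves.Rank1Residual
  Literature.NumberTheory.EllipticCurves.Rank1Residual.Typed
  Literature.NumberTheory.EllipticCurves.Wuthrich2014
  Literature.NumberTheory.EllipticCurves.BalakrishnanEtAl2019
  Literature.NumberTheory.EllipticCurves.Skinner2016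
  Literature.NumberTheory.QuadraticFields.Quadratic
  Literature.NumberTheory.Automorphic
  Literature.NumberTheory.GaloisRepresentations Literature.NumberTheory.GaloisCohomology
  Summit.BirchSwinnertonDyer.Rank1Residual.X11b.AcSelmer
  Summit.BirchSwinnertonDyer.Rank1Residual.X11b.LocBridge

namespace Summit.BirchSwinnertonDyer.Rank1Residual.X11b.Three

/-! ### §1. The three typed inputs of the corner -/

/-- OPEN (typed open input, no source, CONSTRUCTION-SHAPED; implied by the anticyclotomic main
conjecture ∘ BDP formula at `3 ∥ N`) — **`CornerStepLAt W`: STEP L at `3` on the (T4″)@3 CORNER, S0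
currency, i.e. `Three.StepLAt W` VERBATIM with its antecedent `Surj W 3` replaced by `¬ Surj W 3`.**
For `W/ℚ` globally minimal with `(E,3) ∈` X11b and `ρ̄_{E,3}` NOT surjective (hence `¬Ram`,
`3 ∣ ord₃ Δ_min`): for every imaginary quadratic `K` with `d_K` odd satisfying the Heegner hypothesis
for `N = N_E` and `L(E^{d_K},1) ≠ 0`, every modular parametrisation `Dt` of level `N_E` with `3 ∤ c`,
every Heegner datum `H` with `P ∈ E(K)` THE Heegner point of infinite order, every anticyclotomic
`ℤ₃`-extension `κ` with generator `γ` and degree-one `𝔭 ∣ 3`: `IMCLowerWaldspurgerOnTreeAt 3 κ 𝔭 γ embAt P`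
("`Ch_Λ(X_ac) ⊆ (L_𝔭^{BDP}(f))` read at `𝟙` through Castella 2018 Thm. 3.2's value":
`2·(ord₃ log_ω P − 1) ≤ ord₃ f_ac(0)`). NO source at `3` even with `Surj` (S0); on the corner NO
printed anticyclotomic divisibility at ANY `p` (Howard 2004 "`Gal(K̄/K) → Aut(T)` surjective", Castella
2018, Fouquet–Wan 2021 all need an image containing `SL₂`). Image-free passage to Gross–Zagier
currency: `indexLowerBoundAt_of_cornerStepLAt`. A predicate on `W`; NEVER a theorem in this cell;
every result using it is CONDITIONAL; X11 ∧ `r = 1` ∧ `p = 3` stays CONSTRUCTION-SHAPED (R6.2).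
[cite: Castella2018, Thm. 3.2 (arXiv:1704.06608 p. 9) (shape only, read at p = 3 without Surj; nothing asserted)] -/
@[conjecture] def CornerStepLAt (W : WeierstrassCurve ℚ) [W.IsElliptic] [W.IsGloballyMinimal] : Prop :=
  ∀ (N : ℕ) [NeZero N] (K : Type) [Field K] [NumberField K]
    (Dt : ModularParametrizationData W N) (H : HeegnerDatum N (NumberField.discr K)) (ι : K →+* ℂ)
    (P : (W.baseChange K).toAffine.Point),
    ClassX11b W 3 → ¬ Surj W 3 → W.conductorNorm ℤ = N → IsImaginaryQuadratic K →
    Odd (NumberField.discr K) → SatisfiesHeegnerHypothesis N K →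
    (W.quadraticTwist (NumberField.discr K : ℚ)).entireLFunction 1 ≠ 0 →
    WeierstrassCurve.Affine.Point.map ι.toRatAlgHom P = heegnerPointComplex Dt H →
    ¬ (3 : ℤ) ∣ Dt.c → ¬ IsOfFinAddOrder P →
    ∀ (κ : ZpExtension K 3), κ.IsAnticyclotomic →
      ∀ (γ : Field.absoluteGaloisGroup K) [Fact (κ.IsTopGenerator γ)]
        (𝔭 : HeightOneSpectrum (𝓞 K)) (h𝔭 : ((3 : ℕ) : 𝓞 K) ∈ 𝔭.asIdeal)
        (he : 𝔭.asIdeal.ramificationIdx (𝓞 ℚ) = 1) (hf : 𝔭.asIdeal.inertiaDeg (𝓞 ℚ) = 1),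
        IMCLowerWaldspurgerOnTreeAt 3 κ 𝔭 γ (embAt K 3 𝔭 h𝔭 he hf) P

/-- OPEN (typed open input, no source, CONSTRUCTION-SHAPED; = Miller's `BSD(E^{d_K},3)` for the
Heegner twists) — **`CornerTwistAt W`: the rank-`0` `3`-part of BSD for the Heegner twists of a
(T4″)@3 corner pair.** For `W/ℚ` globally minimal with `(E,3) ∈` X11b, `¬ Surj W 3`: for every
imaginary quadratic `K` with `d_K` odd, Heegner for `N_E`, `L(E^{d_K},1) ≠ 0`, and every globally
minimal model `Wd = Cd • E^{(d_K)}` of the twist: `BSDp Wd 3`. The twist pair `(E^{d_K}, 3)` is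
analytic rank `0`, split multiplicative at `3` (`3` splits in `K`), `E^{d_K}[3]` irreducible and NOT
surjective (`ρ̄ ⊗ χ_{d_K}`), WITHOUT a (ram) prime (`v_ℓ(Δ)` unchanged off `d_K`) — the rank-`0` corner;
in print its `≤`-half is Wuthrich 2014 Prop. 21 (surjective-or-Borel: VOID) / Kato 2004 Thm. 17.4
(image `⊇ SL₂(ℤ₃)`: VOID), its `≥`-half Skinner 2016 Thm. C / Skinner–Urban 2014 Thm. 2 ((ram): VOID).
Road (b) feeds BOTH halves of `E` through it (Jetchev–Skinner–Wan 2017 §7.4.1/§7.4.2); in the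
chain's display currency `PPartRankZero Wd 3` via `pPartRankZero_of_cornerTwistAt`. A predicate on
`W`; NEVER a theorem in this cell; every result using it is CONDITIONAL.
[cite: Miller2011LMS, Def. 1.1 (arXiv:1010.2431 p. 3) (shape)] [cite: Skinner2016PacificMC, Thm. C (display; VOID here — shape only)] -/
@[conjecture] def CornerTwistAt (W : WeierstrassCurve ℚ) [W.IsElliptic] [W.IsGloballyMinimal] : Prop :=
  ∀ (K : Type) [Field K] [NumberField K]
    (Wd : WeierstrassCurve ℚ) [Wd.IsElliptic] [Wd.IsGloballyMinimal] (Cd : VariableChange ℚ),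
    ClassX11b W 3 → ¬ Surj W 3 → IsImaginaryQuadratic K → Odd (NumberField.discr K) →
    SatisfiesHeegnerHypothesis (W.conductorNorm ℤ) K →
    (W.quadraticTwist (NumberField.discr K : ℚ)).entireLFunction 1 ≠ 0 →
    Cd • W.quadraticTwist (NumberField.discr K : ℚ) = Wd → BSDp Wd 3

/-- OPEN (typed open input, no source, CONSTRUCTION-SHAPED; implied by `BSD₃(E/K)` in Gross's
Heegner-index form) — **`CornerUpperAt W`: the Tamagawa-SHARP Kolyvagin bound over `K` on the
(T4″)@3 corner with `3 ∣ ∏_ℓ c_ℓ(E)`, NO `Surj`, NO (ram).** For `W/ℚ` globally minimal with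
`(E,3) ∈` X11b, `¬ Surj W 3`, `3 ∣ ∏_ℓ c_ℓ(E)` (ALL 129 split-corner pairs: `c₃ = ord₃ Δ_min ≡ 0
mod 3`; and the 79 non-split corner pairs carried by a split multiplicative `ℓ ≠ 3`): at every
odd-`d_K` Manin-good Heegner datum (as in `CornerStepLAt`) with `Ш(E/K)` finite:
`ord₃ #Ш(E/K) + 2·ord₃ ∏_ℓ c_ℓ(E) ≤ 2·ord₃ [E(K):ℤP]` — Kolyvagin's shape SHARPENED by the whole
Tamagawa term of BSD over `K` (`K_w = ℚ_ℓ` at both `w ∣ ℓ ∣ N`). Its UNSHARP version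
`ord₃ #Ш(E/K) ≤ 2·ord₃ [E(K):ℤP]` is PUBLISHED and registered without image hypothesis
(`MatarNekovar2019.thm03_padicValNat_card_sha_le_of_irreducible`; Cha 2005 Thm. 21) and leaves here a
defect `≥ 2·ord₃ c₃ ≥ 2` (x11b3-p8 `padicValNat_shaOrder_le_add_of_matarNekovar`); the sharpening has
NO source (Jetchev 2008 Thm. 1.1: `p ∤ N` and `ρ̄` onto — fails twice; W. Zhang 2014 / (U-Sh)
displays: `p ≥ 5`, big image). It is the (T2α)@3 / (T2β)@3 upper binder of the class record
restated WITHOUT `Ram`/`Surj`. With `CornerTwistAt` it gives the `ℚ`-level Euler-system half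
(`missingUpperBoundAt_of_cornerUpperAt`). A predicate on `W`; NEVER a theorem in this cell; every
result using it is CONDITIONAL. [cite: JetchevSkinnerWan2017, §7.4.2 (eq:shaupper), p. 31 (shape)]
[cite: Jetchev2008, Thm. 1.1 (shape; hypotheses p ∤ N, ρ̄ onto NOT met — nothing asserted)]
[cite: GrossLMS1991, §2 Conj. (2.2) (shape)] -/
@[conjecture] def CornerUpperAt (W : WeierstrassCurve ℚ) [W.IsElliptic] [W.IsGloballyMinimal] : Prop :=
  ∀ (N : ℕ) [NeZero N] (K : Type) [Field K] [NumberField K]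
    (Dt : ModularParametrizationData W N) (H : HeegnerDatum N (NumberField.discr K)) (ι : K →+* ℂ)
    (P : (W.baseChange K).toAffine.Point),
    ClassX11b W 3 → ¬ Surj W 3 → 3 ∣ W.tamagawaProduct → W.conductorNorm ℤ = N →
    IsImaginaryQuadratic K → Odd (NumberField.discr K) → SatisfiesHeegnerHypothesis N K →
    (W.quadraticTwist (NumberField.discr K : ℚ)).entireLFunction 1 ≠ 0 →
    WeierstrassCurve.Affine.Point.map ι.toRatAlgHom P = heegnerPointComplex Dt H →
    ¬ (3 : ℤ) ∣ Dt.c → ¬ IsOfFinAddOrder P → Finite (W.baseChange K).sha →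
    padicValNat 3 (W.baseChange K).shaOrder + 2 * padicValNat 3 W.tamagawaProduct ≤
      2 * padicValNat 3 (AddSubgroup.zmultiples P).index

/-! ### §2. Bridges (image-free theorems) -/

/-- **`CornerStepLAt` ⇒ STEP L in Gross–Zagier currency at a datum** (`IndexLowerBoundAt W 3 K P`:
`2·ord₃ [E(K):ℤP] ≤ ord₃ #Ш(E/K) + 2·ord₃ ∏_ℓ c_ℓ(E)`), for a corner pair and an odd-`d_K` Manin-good
Heegner datum: multr1-p2's IMAGE-FREE `indexLowerBoundAt_of_heegner_of_openInput_prime` (control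
theorem from (irr) and `3 ∥ N`; `P ∉ E(K)_tors` and `(κ, γ, 𝔭)` from Gross–Zagier, reciprocity).
PUBLISHED binders `hGZ`, `hKo`, `hmod`, Poitou–Tate `hPT`, local Euler characteristic `hEP`.
CONDITIONAL on `CornerStepLAt W`. [cite: JetchevSkinnerWan2017, §7.4.1 (eq:shalowerK-1), p. 30]
[cite: Castella2018, Thm. 2.3 (p. 5), Thm. 3.2 (p. 9) (shape)] [cite: MilneADT2006, Ch. I, Thm. 4.10(b) and Thm. 2.8] -/
theorem indexLowerBoundAt_of_cornerStepLAt [Fact (Nat.Prime 3)]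
    (hGZ : ∀ (N : ℕ) [NeZero N] (W : WeierstrassCurve ℚ) (K : Type) [Field K] [NumberField K],
      gross_zagier N W K)
    (hKo : ∀ (N : ℕ) [NeZero N] (W : WeierstrassCurve ℚ) (K : Type) [Field K] [NumberField K],
      kolyvagin N W K)
    (hmod : hasEntireLFunction_rat)
    (hPT : ∀ (K : Type) [Field K] [NumberField K], poitouTate_sum_localTatePairing_eq_zero K)
    (hEP : ∀ (K : Type) [Field K] [NumberField K] (v : HeightOneSpectrum (𝓞 K)),
      localEulerPoincareCharacteristic (v.adicCompletion K))
    (W : WeierstrassCurve ℚ) [W.IsElliptic] [W.IsGloballyMinimal] (hX : ClassX11b W 3)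
    (hns : ¬ Surj W 3) (hSL : CornerStepLAt W)
    (N : ℕ) [NeZero N] (K : Type) [Field K] [NumberField K]
    (Dt : ModularParametrizationData W N) (H : HeegnerDatum N (NumberField.discr K)) (ι : K →+* ℂ)
    (P : (W.baseChange K).toAffine.Point)
    (hN : W.conductorNorm ℤ = N) (hK : IsImaginaryQuadratic K) (hodd : Odd (NumberField.discr K))
    (hHN : SatisfiesHeegnerHypothesis N K)
    (hLt : (W.quadraticTwist (NumberField.discr K : ℚ)).entireLFunction 1 ≠ 0)
    (hP : WeierstrassCurve.Affine.Point.map ι.toRatAlgHom P = heegnerPointComplex Dt H)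
    (hc : ¬ (3 : ℤ) ∣ Dt.c) : IndexLowerBoundAt W 3 K P := by
  obtain ⟨hr, -, hmult, hirr⟩ := id hX
  have hPinf : ¬ IsOfFinAddOrder P :=
    not_isOfFinAddOrder_of_heegner_of_analyticRank_eq_one W N K Dt H ι P (hGZ N W K) hmod hr hK hHN
      hLt hP
  exact indexLowerBoundAt_of_heegner_of_openInput_prime W 3 N K Dt H ι P (hGZ N W K) hKo hmod hPT
    hEP hr hmult hirr hN hK hHN hLt hP (hSL N K Dt H ι P hX hns hN hK hodd hHN hLt hP hc hPinf)

/-- **`CornerTwistAt` ⇒ the twist's rank-`0` print shape `PPartRankZero Wd 3`** (Skinner's display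
= Jetchev–Skinner–Wan Thm. 7.2.1 shape: `ord₃ (L(E^{d_K},1)/Ω) = ord₃ #Ш + ord₃ ∏c − 2·ord₃ #tors`),
whose two halves are the `htw` inputs of `missingLowerBoundAt_of_indexLowerBoundAt` /
`missingUpperBoundAt_of_shaIndexBound(_sharp)`. Bookkeeping: `BSDp ⇒ PPart ⇒ PPartRankZero`
(`pPart_of_bsdp`, `pPartRankZero_of_pPart`; `r_an(E^{d_K}) = 0` from `L(E^{d_K},1) ≠ 0` by modularity
`hmod`; GZK `hGZK`). CONDITIONAL on `CornerTwistAt W`. [cite: Miller2011LMS, §1 and Def. 1.1]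
[cite: Skinner2016PacificMC, Thm. C (display; shape only)] -/
theorem pPartRankZero_of_cornerTwistAt [Fact (Nat.Prime 3)] (hmod : hasEntireLFunction_rat)
    (hGZK : rank_eq_analyticRank_of_analyticRank_le_one)
    (W : WeierstrassCurve ℚ) [W.IsElliptic] [W.IsGloballyMinimal] (hX : ClassX11b W 3)
    (hns : ¬ Surj W 3) (hTw : CornerTwistAt W)
    (K : Type) [Field K] [NumberField K]
    (Wd : WeierstrassCurve ℚ) [Wd.IsElliptic] [Wd.IsGloballyMinimal] (Cd : VariableChange ℚ)
    (hK : IsImaginaryQuadratic K) (hodd : Odd (NumberField.discr K))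
    (hHN : SatisfiesHeegnerHypothesis (W.conductorNorm ℤ) K)
    (hLt : (W.quadraticTwist (NumberField.discr K : ℚ)).entireLFunction 1 ≠ 0)
    (hWd : Cd • W.quadraticTwist (NumberField.discr K : ℚ) = Wd) : PPartRankZero Wd 3 := by
  have hbsd : BSDp Wd 3 := hTw K Wd Cd hX hns hK hodd hHN hLt hWd
  have hD0 : (NumberField.discr K : ℚ) ≠ 0 := by exact_mod_cast NumberField.discr_ne_zero K
  haveI hEt : (W.quadraticTwist (NumberField.discr K : ℚ)).IsElliptic :=
    W.isElliptic_quadraticTwist hD0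
  have hLt' : (W.quadraticTwist (NumberField.discr K : ℚ)).entireLFunction = Wd.entireLFunction := by
    rw [← hWd, entireLFunction_smul]
  have hLd1 : Wd.entireLFunction 1 ≠ 0 := by rw [← hLt']; exact hLt
  have hrd : Wd.analyticRank = 0 := (Wd.analyticRank_eq_zero_iff_holds (hmod Wd)).2 hLd1
  exact pPartRankZero_of_pPart hGZK Wd 3 hrd (pPart_of_bsdp hmod hGZK Wd 3 (by omega) hbsd)

/-- **`CornerUpperAt` + `CornerTwistAt` ⇒ the `ℚ`-level Euler-system half `ord₃ #Ш(E) ≤ ord₃ #Ш(E)_an`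
on corner pairs with `3 ∣ ∏_ℓ c_ℓ(E)`** — the form x11b3-p3's whole-corner chain consumes. At the
odd-`d_K` Manin-good Heegner datum of `exists_oddHeegnerData` (Hoffstein–Luo field `hHL`, newform
`hnf`, Mazur 1978 Cor. 4.1 `hMaz`; Néron scaling a theorem): the sharp bound (`CornerUpperAt`) and the
twist's `≥`-half (from `CornerTwistAt` via `pPartRankZero_of_cornerTwistAt`) give
`Typed.MissingUpperBoundAt W 3` by x11b3-p5's `missingUpperBoundAt_of_shaIndexBound_sharp` with weight
`w = ord₃ ∏c_ℓ(E)`; the transports `ord₃ u(Cd) = 0`, `ord₃ ∏c(Wd) = ord₃ ∏c(W)` are theorems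
(`padicValRat_u_eq_zero_of_twist_minimal`, `X2.padicValNat_tamagawaProduct_twist_of_heegner_of_odd`);
`Ш(E/K)` finite by Gross–Zagier + Kolyvagin. PUBLISHED binders `hGZ`, `hKo`, `hGZK`, `hmod`, `hnf`,
`hHL`, `hMaz`. NO `Surj`, NO `Ram`. CONDITIONAL on the two inputs; nothing booked.
[cite: JetchevSkinnerWan2017, §7.4.2 (eq:shaupper), p. 31] [cite: HoffsteinLuo1997, Theorem (§1)]
[cite: Mazur1978, Cor. 4.1] [cite: Miller2011LMS, Def. 1.1] -/
theorem missingUpperBoundAt_of_cornerUpperAt [Fact (Nat.Prime 3)]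
    (hGZ : ∀ (N : ℕ) [NeZero N] (W : WeierstrassCurve ℚ) (K : Type) [Field K] [NumberField K],
      gross_zagier N W K)
    (hKo : ∀ (N : ℕ) [NeZero N] (W : WeierstrassCurve ℚ) (K : Type) [Field K] [NumberField K],
      kolyvagin N W K)
    (hGZK : rank_eq_analyticRank_of_analyticRank_le_one) (hmod : hasEntireLFunction_rat)
    (hnf : exists_isNewformOf) (hHL : HoffsteinLuo1997_exists_twist_L_one_ne_zero)
    (hMaz : mazur_not_dvd_maninConstant_of_odd)
    (W : WeierstrassCurve ℚ) [W.IsElliptic] [W.IsGloballyMinimal] (hX : ClassX11b W 3)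
    (hns : ¬ Surj W 3) (ht : 3 ∣ W.tamagawaProduct) (hU : CornerUpperAt W) (hTw : CornerTwistAt W) :
    Typed.MissingUpperBoundAt W 3 := by
  have hNS : integral_neronScaling_of_isGloballyMinimal :=
    integral_neronScaling_of_isGloballyMinimal_holds
  obtain ⟨hr, hp2, hmult, hirr⟩ := id hX
  haveI : NeZero (W.conductorNorm ℤ) := ⟨(W.conductorNorm_pos_holds).ne'⟩
  obtain ⟨K, _, _, Dt, H, ι, P, Wd, _, _, Cd, hK, hodd, hpd, hHN, hP, hc, hμ, hLt, hWd⟩ :=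
    exists_oddHeegnerData hnf hHL hMaz hNS W 3 hr hp2 hmult hirr
  have htam : padicValNat 3 Wd.tamagawaProduct = padicValNat 3 W.tamagawaProduct :=
    X2.padicValNat_tamagawaProduct_twist_of_heegner_of_odd W 3 hp2 K hK hodd hpd hHN Cd hWd
  have hu : padicValRat 3 (Cd.u : ℚ) = 0 :=
    padicValRat_u_eq_zero_of_twist_minimal W 3 K hK hHN hmult Cd hWd
  obtain ⟨qd, hqd, hv⟩ :=
    pPartRankZero_of_cornerTwistAt hmod hGZK W hX hns hTw K Wd Cd hK hodd hHN hLt hWd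
  exact missingUpperBoundAt_of_shaIndexBound_sharp W 3 (W.conductorNorm ℤ) K Dt H ι P (hGZ _ W K)
    (hKo _ W K) hGZK hmod hK hHN hP hp2 hc hμ hr hLt Wd Cd hWd hu htam le_rfl ⟨qd, hqd, hv.le⟩
    (fun hfin hPinf ↦ hU (W.conductorNorm ℤ) K Dt H ι P hX hns ht rfl hK hodd hHN hLt hP hc hPinf hfin)

end Summit.BirchSwinnertonDyer.Rank1Residual.X11b.Three

end
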